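import Literature.AlgebraicGeometry.Shioda1982.ExceptionalQuadruplesComplete
import Literature.AlgebraicGeometry.Shioda1982.ExceptionalQuadruplesComplete120
import Literature.AlgebraicGeometry.Shioda1982.ExceptionalQuadruplesComplete180
import Literature.AlgebraicGeometry.Shioda1982.ExceptionalQuadruplesSweepNinety
import Literature.AlgebraicGeometry.Shioda1982.ExceptionalQuadruplesSweepOneHundredTwelve
import Literature.AlgebraicGeometry.Shioda1982.ExceptionalQuadruplesSweepOneHundredThirtyTwo
import Literature.AlgebraicGeometry.Shioda1982.ExceptionalQuadruplesSweepNinetyOneToOneHundredThree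
import Literature.AlgebraicGeometry.Shioda1982.ExceptionalQuadruplesSweepOneHundredFourToOneHundredThirteen
import Literature.AlgebraicGeometry.Shioda1982.ExceptionalQuadruplesSweepOneHundredFourteenToOneHundredTwentyOne
import Literature.AlgebraicGeometry.Shioda1982.ExceptionalQuadruplesSweepOneHundredTwentyTwoToOneHundredTwentyEight
import Literature.AlgebraicGeometry.Shioda1982.ExceptionalQuadruplesSweepOneHundredTwentyNineToOneHundredThirtyFive
import Literature.AlgebraicGeometry.Shioda1982.ExceptionalQuadruplesSweepOneHundredThirtySixToOneHundredForty
import Literature.AlgebraicGeometry.Shioda1982.ExceptionalQuadruplesSweepOneHundredFortyOneToOneHundredFortyFive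
import Literature.AlgebraicGeometry.Shioda1982.ExceptionalQuadruplesSweepOneHundredFortySixToOneHundredFortyNine
import Literature.AlgebraicGeometry.Shioda1982.ExceptionalQuadruplesSweepOneHundredFiftyToOneHundredFiftyThree
import Literature.AlgebraicGeometry.Shioda1982.ExceptionalQuadruplesSweepOneHundredFiftyFourToOneHundredFiftySeven
import Literature.AlgebraicGeometry.Shioda1982.ExceptionalQuadruplesSweepOneHundredFiftyEightToOneHundredSixty
import Literature.AlgebraicGeometry.Shioda1982.ExceptionalQuadruplesSweepOneHundredSixtyOneToOneHundredSixtyThree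
import Literature.AlgebraicGeometry.Shioda1982.ExceptionalQuadruplesSweepOneHundredSixtyFourToOneHundredSixtySix
import Literature.AlgebraicGeometry.Shioda1982.ExceptionalQuadruplesSweepOneHundredSixtySevenToOneHundredSixtyNine
import Literature.AlgebraicGeometry.Shioda1982.ExceptionalQuadruplesSweepOneHundredSeventyToOneHundredSeventyOne
import Literature.AlgebraicGeometry.Shioda1982.ExceptionalQuadruplesSweepOneHundredSeventyTwoToOneHundredSeventyThree
import Literature.AlgebraicGeometry.Shioda1982.ExceptionalQuadruplesSweepOneHundredSeventyFourToOneHundredSeventyFive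
import Literature.AlgebraicGeometry.Shioda1982.ExceptionalQuadruplesSweepOneHundredSeventySixToOneHundredSeventySeven
import Literature.AlgebraicGeometry.Shioda1982.ExceptionalQuadruplesSweepOneHundredSeventyEightToOneHundredSeventyNine
import HarnessLib

/-!
# Meyer–Neutsch 1981, Tabelle 1 / Shioda 1982, table p. 727: the classification of the exceptional Fermat quadruples is COMPLETE at every level `N ≤ 180` (kernel)

Topic `Literature/AlgebraicGeometry/Shioda1982`. THEOREMS only (no definition, no named fact), assembling the kernel certificates of
`ExceptionalQuadruplesComplete.lean` (the printed list is complete at each of its 19 levels `≤ 90`), `ExceptionalQuadruplesComplete120.lean`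
(`120, 156`), `ExceptionalQuadruplesComplete180.lean` (`180`), the sweeps `ExceptionalQuadruplesSweepSixty/…/Ninety.lean` (all `2 ≤ N ≤ 90`:
`tabelleOneCompleteAt_of_le_ninety`), `…SweepOneHundredTwelve.lean`, `…SweepOneHundredThirtyTwo.lean` and the 19 files
`ExceptionalQuadruplesSweep<lo>To<hi>.lean` (every other level `91 ≤ N ≤ 179`) into ONE statement:
**`tabelleOneCompleteAt_of_le_oneHundredEighty`** — for every `2 ≤ N ≤ 180`, every sorted Hodge 4-multiset mod `N` without a pair and with
`gcd = 1` is a standard quadruple or a unit multiple of a representative printed in [MeyerNeutsch1981Fermatquadrupel, Tabelle 1] at level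
`N` — with the invariant corollaries **`exists_mem_reps_of_isExceptionalQuadruple_of_le_oneHundredEighty`** (an exceptional quadruple of
level `N ≤ 180` is a unit multiple of a printed representative) and **`not_isExceptionalQuadruple_of_le_oneHundredEighty`** (no exceptional
quadruple at the levels `N ≤ 180` off the table, `tabelleOne N = []`: the zeros of Shioda's table). This is the machine form of Meyer–Neutsch's
computer statement "alle Fermatquadrupel für N ≤ 614 ermittelt" (§2 p. 53) on the range `N ≤ 180` of their Tabelle 1 (101 orbits at 22 levels,
`tabelleOne_total`), i.e. on the whole range where exceptional quadruples exist by Aoki's Theorem C ([Aoki1983]: none for `m > 180`,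
computer-assisted for `181 ≤ m ≤ 672` — NOT a kernel statement; the cell re-verified that range by two programs, `lit/Aoki1983-Sections6-9.md`).
`decide +kernel` throughout the imported files (no `native_decide`); this file only dispatches on `N` (`interval_cases`).

HONEST FRAMING (cell `pub-hfermat`): explicit algebraic cycles for specific Hodge classes on Fermat/Delsarte varieties; residual open
instances listed; no claim on general Hodge. These surface classes are algebraic (Lefschetz (1,1)); certified here is the completeness of
the printed classification, not any cycle.

## References
* [MeyerNeutsch1981Fermatquadrupel] W. Meyer, W. Neutsch, *Fermatquadrupel*, Math. Ann. 256 (1981) 51–62, §2 p. 53, Tabelle 1 p. 54.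
* [Shioda1982PicardFermat] T. Shioda, J. Fac. Sci. Univ. Tokyo IA 28 (1982) 725–734, table p. 727.
* [Aoki1983] N. Aoki, Math. Ann. 266 (1983) 23–54, Thm. C.
-/

namespace Literature.AlgebraicGeometry.Shioda1982

open Literature.AlgebraicGeometry.HodgeTheory

/-- **Tabelle 1 is complete at every level `2 ≤ N ≤ 180`**: every sorted Hodge 4-multiset `{a, b, c, −(a+b+c)}` mod `N` without a
pair and with `gcd = 1` is a standard quadruple or a unit multiple of a representative printed at level `N` (`reps N`; empty off the 22
table levels). Dispatch on `N`: `N ≤ 90` by `tabelleOneCompleteAt_of_le_ninety`, `91 ≤ N ≤ 180` by the per-level kernel certificates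
`completeAt_<N>`. [cite: MeyerNeutsch1981Fermatquadrupel, §2 p. 53 ("alle Fermatquadrupel für N ≤ 614 ermittelt") and Tabelle 1 p. 54]
[cite: Shioda1982PicardFermat, table p. 727] -/
theorem tabelleOneCompleteAt_of_le_oneHundredEighty (N : ℕ) [NeZero N] (h2 : 2 ≤ N) (h : N ≤ 180) : TabelleOneCompleteAt N := by
  rcases Nat.lt_or_ge N 91 with h90 | h91
  · exact tabelleOneCompleteAt_of_le_ninety N h2 (by omega)
  interval_cases N
  · exact completeAt_ninetyOne
  · exact completeAt_ninetyTwo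
  · exact completeAt_ninetyThree
  · exact completeAt_ninetyFour
  · exact completeAt_ninetyFive
  · exact completeAt_ninetySix
  · exact completeAt_ninetySeven
  · exact completeAt_ninetyEight
  · exact completeAt_ninetyNine
  · exact completeAt_oneHundred
  · exact completeAt_oneHundredOne
  · exact completeAt_oneHundredTwo
  · exact completeAt_oneHundredThree
  · exact completeAt_oneHundredFour
  · exact completeAt_oneHundredFive
  · exact completeAt_oneHundredSix
  · exact completeAt_oneHundredSeven
  · exact completeAt_oneHundredEight
  · exact completeAt_oneHundredNine
  · exact completeAt_oneHundredTen
  · exact completeAt_oneHundredEleven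
  · exact completeAt_oneHundredTwelve
  · exact completeAt_oneHundredThirteen
  · exact completeAt_oneHundredFourteen
  · exact completeAt_oneHundredFifteen
  · exact completeAt_oneHundredSixteen
  · exact completeAt_oneHundredSeventeen
  · exact completeAt_oneHundredEighteen
  · exact completeAt_oneHundredNineteen
  · exact completeAt_oneHundredTwenty
  · exact completeAt_oneHundredTwentyOne
  · exact completeAt_oneHundredTwentyTwo
  · exact completeAt_oneHundredTwentyThree
  · exact completeAt_oneHundredTwentyFour
  · exact completeAt_oneHundredTwentyFive
  · exact completeAt_oneHundredTwentySix
  · exact completeAt_oneHundredTwentySeven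
  · exact completeAt_oneHundredTwentyEight
  · exact completeAt_oneHundredTwentyNine
  · exact completeAt_oneHundredThirty
  · exact completeAt_oneHundredThirtyOne
  · exact completeAt_oneHundredThirtyTwo
  · exact completeAt_oneHundredThirtyThree
  · exact completeAt_oneHundredThirtyFour
  · exact completeAt_oneHundredThirtyFive
  · exact completeAt_oneHundredThirtySix
  · exact completeAt_oneHundredThirtySeven
  · exact completeAt_oneHundredThirtyEight
  · exact completeAt_oneHundredThirtyNine
  · exact completeAt_oneHundredForty
  · exact completeAt_oneHundredFortyOne
  · exact completeAt_oneHundredFortyTwo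
  · exact completeAt_oneHundredFortyThree
  · exact completeAt_oneHundredFortyFour
  · exact completeAt_oneHundredFortyFive
  · exact completeAt_oneHundredFortySix
  · exact completeAt_oneHundredFortySeven
  · exact completeAt_oneHundredFortyEight
  · exact completeAt_oneHundredFortyNine
  · exact completeAt_oneHundredFifty
  · exact completeAt_oneHundredFiftyOne
  · exact completeAt_oneHundredFiftyTwo
  · exact completeAt_oneHundredFiftyThree
  · exact completeAt_oneHundredFiftyFour
  · exact completeAt_oneHundredFiftyFive
  · exact completeAt_oneHundredFiftySix
  · exact completeAt_oneHundredFiftySeven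
  · exact completeAt_oneHundredFiftyEight
  · exact completeAt_oneHundredFiftyNine
  · exact completeAt_oneHundredSixty
  · exact completeAt_oneHundredSixtyOne
  · exact completeAt_oneHundredSixtyTwo
  · exact completeAt_oneHundredSixtyThree
  · exact completeAt_oneHundredSixtyFour
  · exact completeAt_oneHundredSixtyFive
  · exact completeAt_oneHundredSixtySix
  · exact completeAt_oneHundredSixtySeven
  · exact completeAt_oneHundredSixtyEight
  · exact completeAt_oneHundredSixtyNine
  · exact completeAt_oneHundredSeventy
  · exact completeAt_oneHundredSeventyOne
  · exact completeAt_oneHundredSeventyTwo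
  · exact completeAt_oneHundredSeventyThree
  · exact completeAt_oneHundredSeventyFour
  · exact completeAt_oneHundredSeventyFive
  · exact completeAt_oneHundredSeventySix
  · exact completeAt_oneHundredSeventySeven
  · exact completeAt_oneHundredSeventyEight
  · exact completeAt_oneHundredSeventyNine
  · exact completeAt_oneHundredEighty

/-- **Every exceptional quadruple of level `2 ≤ N ≤ 180` is a unit multiple of a representative printed in Tabelle 1 at level `N`.**
[cite: MeyerNeutsch1981Fermatquadrupel, §2 p. 53 and Tabelle 1 p. 54] [cite: Shioda1982PicardFermat, table p. 727] -/
theorem exists_mem_reps_of_isExceptionalQuadruple_of_le_oneHundredEighty {N : ℕ} [NeZero N] (h2 : 2 ≤ N) (h : N ≤ 180)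
    {s : Multiset (ZMod N)} (hs : IsExceptionalQuadruple N s) :
    ∃ r ∈ reps N, ∃ t : (ZMod N)ˣ, s = r.map (fun x ↦ (t : ZMod N) * x) :=
  exists_mem_reps_of_isExceptionalQuadruple (tabelleOneCompleteAt_of_le_oneHundredEighty N h2 h) hs

/-- **No exceptional quadruple at the levels `2 ≤ N ≤ 180` absent from Tabelle 1** (`tabelleOne N = []`: the 157 zeros of Shioda's
table in this range), kernel-checked level by level. [cite: Shioda1982PicardFermat, table p. 727] [cite: MeyerNeutsch1981Fermatquadrupel, Tabelle 1 p. 54] -/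
theorem not_isExceptionalQuadruple_of_le_oneHundredEighty (N : ℕ) [NeZero N] (h2 : 2 ≤ N) (h : N ≤ 180) (htab : tabelleOne N = [])
    (s : Multiset (ZMod N)) : ¬ IsExceptionalQuadruple N s := by
  intro hs
  obtain ⟨r, hr, -⟩ := exists_mem_reps_of_isExceptionalQuadruple_of_le_oneHundredEighty h2 h hs
  simp [reps, htab] at hr

/-- **The levels of the exceptional quadruples up to `180` are exactly the 22 table levels**: an exceptional quadruple of level
`2 ≤ N ≤ 180` forces `N ∈ {12, 14, 15, 18, 20, 21, 24, 28, 30, 36, 40, 42, 48, 60, 66, 72, 78, 84, 90, 120, 156, 180}` (the levels `N ≤ 180`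
of Meyer–Neutsch's Tabelle 1; conversely every one of these levels carries one, `ExceptionalQuadruples.level_<N>`).
[cite: Shioda1982PicardFermat, table p. 727] [cite: MeyerNeutsch1981Fermatquadrupel, Tabelle 1 p. 54] -/
theorem mem_levels_of_isExceptionalQuadruple_of_le_oneHundredEighty {N : ℕ} [NeZero N] (h2 : 2 ≤ N) (h : N ≤ 180)
    {s : Multiset (ZMod N)} (hs : IsExceptionalQuadruple N s) :
    N ∈ [12, 14, 15, 18, 20, 21, 24, 28, 30, 36, 40, 42, 48, 60, 66, 72, 78, 84, 90, 120, 156, 180] := by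
  by_contra hN
  refine not_isExceptionalQuadruple_of_le_oneHundredEighty N h2 h ?_ s hs
  interval_cases N <;> first | rfl | decide | exact absurd (by decide) hN

end Literature.AlgebraicGeometry.Shioda1982
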